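import Literature.AlgebraicGeometry.Frobenioids.Cor411iiAssembly
import Literature.AlgebraicGeometry.Frobenioids.PerfectionUnitTrivial
import Literature.AlgebraicGeometry.Frobenioids.Thm42SubAssemblyIGeneral
import Literature.AlgebraicGeometry.Frobenioids.Thm42Assembly
import Literature.AlgebraicGeometry.Frobenioids.Thm42OfPerfectionIsFrobenioid
import Literature.AlgebraicGeometry.Frobenioids.BaseSectionsOfObjectsCor57Slim
import Literature.AlgebraicGeometry.Frobenioids.EquivalenceUnitsStandardType
import Literature.AlgebraicGeometry.Frobenioids.IsoSubanchorNotIsotropic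
import Literature.AlgebraicGeometry.Frobenioids.FrobeniusTypeIsotropic
import Literature.AlgebraicGeometry.Frobenioids.BiratLocalization
import Literature.AlgebraicGeometry.Frobenioids.UnitTrivializationStandardTypeProofs
import Literature.AlgebraicGeometry.Frobenioids.DivisorMonoidCategoryTheoreticityCorProofsVII
import Literature.AlgebraicGeometry.Frobenioids.EquivalenceThm34Assembly
import Literature.AlgebraicGeometry.Frobenioids.IstrStandardTypeProofs
import Literature.AlgebraicGeometry.Frobenioids.Cor412OfFSMType
import HarnessLib

/-!
# Frobenioids I, Corollary 4.11 (ii) AS TYPED over bases of FSM-type (with `Φ_i` perf-factorial) —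
# unconditional, along the author's amended route `C → C^istr → C^un-tr`

Mochizuki, *The geometry of Frobenioids I: the general theory*, Kyushu J. Math. **62** (2008)
293–400, Cor. 4.11 (ii) p. 91 (hypotheses: "`Φ_i` a perf-factorial divisorial monoid on a connected, totally
epimorphic category `D_i` which is Div-slim; `C_i → F_{Φ_i}` a Frobenioid of standard type; `Ψ : C₁ ⥲ C₂` an
equivalence; if `C₁, C₂` are of group-like type … both `Ψ` and some quasi-inverse to `Ψ` preserve
base-isomorphisms"), proof pp. 92–94: "First, we observe [cf. Theorem 3.4, (i)] that we may assume without
loss of generality that `C₁, C₂` are of isotropic type … if `C₁, C₂` are of group-like type [cf. Theorem 3.4,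
(ii)], then "Div-slimness" amounts to "slimness", so assertions (i), (ii) follow from Theorem 3.4, (iv), (v) …
Thus, we may assume without loss of generality that `C₁, C₂` are not of group-like type", together with the
author's *Comments* (Jan. 2024) item (29)(v): "The portion preceding the display of the first sentence in the
proof of Corollary 4.11, (ii), should read as follows: 'First, we observe that, by assertion (i), we may
assume without loss of generality that `C` is of unit-trivial, hence also [cf. Proposition 4.4, (iii)]
birationally Frobenius-normalized type; moreover, we have a 1-commutative diagram'"
[cite: MochizukiFrdI2008, Cor. 4.11 (ii) p.91].

PROOF-ONLY file (seat abc-iut-L1-d6, cell sub-DAG S2 `plan/L1/SUBDAG-FrdI-Cor411.md`, node FrdI:Cor4.11(ii);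
bases of FSM-type are the cell's route to Thm. 3.4 (ii)(iii), seat abc-iut-L1-t13).
* `PreFrobenioid.cor411ii_of_isOfFSMType` — the typed `(ofFunctor Φ₁ F₁).Cor411ii (ofFunctor Φ₂ F₂) Ψ` GIVEN
  that the perfections `(C_i^istr)^pf` of the isotropic parts and their birationalizations are Frobenioids
  (`hPf_i`, `hB_i`; birational squares come for free, `hasBiratSquares_of_isFrobenioid`, seat abc-iut-L6-t8
  lineage). Printed case split: group-like type (preserved by `Ψ` over FSM-type bases,
  `FrdI.isOfGroupLikeType_map`, seat abc-iut-L1-t13) ⇒ Div-slim = slim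
  (`isSlim_of_isDivSlim_of_isOfGroupLikeType`, this seat) and the slim case is Thm. 3.4 (v)
  (`cor411ii_inst_of_isSlim_of_isOfFSMType`, seat abc-iut-w4-d086); else restrict to the isotropic parts
  `C_i^istr` (Thm. 3.4 (i), `Ψ.congrFullSubcategory`) and pass to their perfections — the `FrdI.T42.Setting`
  of the proof of Thm. 4.2 for `Ψ^pf` is the cell's `FrdI.T42.setting_perfection` (seat abc-iut-w4-d090;
  non-group-like objects: the isotropic hulls of non-group-like objects), `Ψ^istr` being compatible with arrows
  of Frobenius type (`isFrobeniusCompatible_of_isOfFSMType`), primary pre-steps by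
  `Setting.isPrimaryPreStep_map` / `Setting.symm` (seats abc-iut-w4-d099 / w5-d162) — and conclude by
  `cor411ii_of_congr_istr_pf` (`Cor411iiAssembly`: the apex of the birational tower and the descent).
* `PreFrobenioid.cor411ii_ofFunctor_of_isOfFSMType` — the typed Cor. 4.11 (ii) with NO further hypothesis,
  by the amended route: the Frobenioid to which the birational tower is applied is `(C^istr)^un-tr`
  (Cor. 4.11 (i): `Ψ^un-tr` over `Ψ^istr`, `cor411i_restrict`, this seat gen 0; its input, the Div-identity
  clause of Thm. 4.2 (i) for `Ψ^istr`, `(Ψ^istr)⁻¹`, is `FrdI.T42.thm42i_ofFunctor_of_isOfFSMType`, seat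
  abc-iut-w5 lineage; `C^istr` is of standard type, Rem. 4.5.1, `isOfStandardType_istr`), which is
  unit-trivial, so that the birationalization of its perfection IS a Frobenioid
  (`Perfection.birat_isFrobenioid_of_isOfUnitTrivialType`: Prop. 4.4 (ii)/(iii) as amended, Thm. 5.1 (iv));
  the perfections themselves are Frobenioids by Prop. 3.2 (iii) (`PreFrobenioid.Perfection.isFrobenioid`,
  seats abc-iut-L1-d9 / L1-d1 / w5 lineage; Frobenius-isotropic type). Floors: `C_i → C_i^istr`
  (isotropification, Thm. 3.4 (i)) `→ (C_i^istr)^un-tr` (`toUntr`, over `D_i` on the nose) with `Ψ^un-tr`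
  over `Ψ` (the square of Cor. 4.11 (i) composed with that of Thm. 3.4 (i),
  `nonempty_isotropification_comp_iso`); the base square of `Ψ^un-tr` by `cor411ii_of_isOfFSMType` applied to
  the Frobenioids `(C_i^istr)^un-tr → F_{Φ_i}` (`untrFunctor`, seat abc-iut-L1-d5; standard type by Prop. 5.5
  (iii), `isOfStandardType_untr`, seat abc-iut-w5 lineage); descent by `cor411ii_of_over` (this seat).
No new definitions; nothing of the paper is restated; nothing here is specific to the abc programme.
-/

namespace Literature.AlgebraicGeometry.Frobenioids

open CategoryTheory Opposite

universe w v v' u u'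

namespace PreFrobenioid

section One

variable {D : Type u} [Category.{v} D] {Φ : Dᵒᵖ ⥤ CommMonCat.{w}}
  {C : Type u'} [Category.{v'} C]

/-- A unit of an object of `C^istr` (for the restricted structure `C^istr → F_Φ`) is a unit of the
underlying object; hence `C^istr` is of unit-trivial type when `C` is. [cite: MochizukiFrdI2008, Def. 1.2 (iv) p.23] -/
theorem isOfUnitTrivialType_istr_of (G : C ⥤ ElemFrobenioid Φ) (hut : IsOfType (IsUnitTrivial G)) :
    IsOfType (IsUnitTrivial (istrFunctor G)) := by
  intro X u hu
  have h : (isotropicObjects G).ι.mapIso u ∈ unitsSubgroup G X.obj := hu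
  have h1 := congrArg Iso.hom (hut X.obj _ h)
  apply Iso.ext
  apply (isotropicObjects G).ι.map_injective
  rw [Functor.mapIso_hom] at h1
  rw [h1]
  exact ((isotropicObjects G).ι.map_id X).symm

end One

section Two

variable {D₁ : Type u} [Category.{v} D₁] {Φ₁ : D₁ᵒᵖ ⥤ CommMonCat.{w}}
  {C₁ : Type u'} [Category.{v'} C₁] {F₁ : C₁ ⥤ ElemFrobenioid Φ₁}
  {D₂ : Type u} [Category.{v} D₂] {Φ₂ : D₂ᵒᵖ ⥤ CommMonCat.{w}}
  {C₂ : Type u'} [Category.{v'} C₂] {F₂ : C₂ ⥤ ElemFrobenioid Φ₂}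

set_option backward.isDefEq.respectTransparency false in
/-- **[FrdI] Cor. 4.11 (ii) AS TYPED, over bases of FSM-type, modulo "the perfections of the isotropic parts
and their birationalizations are Frobenioids"**: for Frobenioids `C_i → F_{Φ_i}` with `Φ_i` perf-factorial over
bases `D_i` of FSM-type, GIVEN that `(C_i^istr)^pf → F_{Φ_i^pf}` are Frobenioids (`hPf_i`, Prop. 3.2 (iii); they then
admit birational squares, `hasBiratSquares_of_isFrobenioid`) whose birationalizations
`((C_i^istr)^pf)^birat → F_{0_{D_i}}` are Frobenioids (`hB_i`, Prop. 4.4 (ii)), the typed Cor. 4.11 (ii) holds for every equivalence `Ψ : C₁ ⥲ C₂`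
(under its `Cor411Setting`: `D_i` Div-slim, `C_i` of standard type, hypothesis (b)). Printed case split on
group-like type; in the non-group-like case the reductions to `C_i^istr` and to `(C_i^istr)^pf` and the apex
of the birational tower. [cite: MochizukiFrdI2008, Cor. 4.11 (ii) p.91] -/
theorem cor411ii_of_isOfFSMType (hF₁ : IsFrobenioid F₁) (hF₂ : IsFrobenioid F₂) (Ψ : C₁ ≌ C₂)
    (hpf₁ : Objectwise (fun M _ => IsPerfFactorial M) Φ₁) (hpf₂ : Objectwise (fun M _ => IsPerfFactorial M) Φ₂)
    (hD₁ : IsOfFSMType D₁) (hD₂ : IsOfFSMType D₂)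
    (hPf₁ : IsFrobenioid (Perfection.ops (isFrobenioid_istr hF₁)).toFunctor)
    (hPf₂ : IsFrobenioid (Perfection.ops (isFrobenioid_istr hF₂)).toFunctor)
    (hB₁ : IsFrobenioid (Birat.toElemZero hPf₁ (hasBiratSquares_of_isFrobenioid hPf₁)))
    (hB₂ : IsFrobenioid (Birat.toElemZero hPf₂ (hasBiratSquares_of_isFrobenioid hPf₂))) :
    (PreFrobenioidData.ofFunctor Φ₁ F₁).Cor411ii (PreFrobenioidData.ofFunctor Φ₂ F₂) Ψ := by
  classical
  intro hs
  have hq₁ := hs.standard.1.quasiIsotropic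
  have hq₂ := hs.standard.2.quasiIsotropic
  by_cases hG₁ : (PreFrobenioidData.ofFunctor Φ₁ F₁).IsOfGroupLikeType
  · -- group-like type: "Div-slimness amounts to slimness", and the slim case is Thm. 3.4 (v)
    have hG₂ : (PreFrobenioidData.ofFunctor Φ₂ F₂).IsOfGroupLikeType :=
      FrdI.isOfGroupLikeType_map hF₁ hF₂ hq₁ hq₂ hD₁ hD₂ Ψ hG₁
    have hsl₁ : IsSlim D₁ := PreFrobenioidData.isSlim_of_isDivSlim_of_isOfGroupLikeType _
      (exists_base_iso_of_isFrobenioid F₁ hF₁) hG₁ hs.divSlim.1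
    have hsl₂ : IsSlim D₂ := PreFrobenioidData.isSlim_of_isDivSlim_of_isOfGroupLikeType _
      (exists_base_iso_of_isFrobenioid F₂ hF₂) hG₂ hs.divSlim.2
    exact cor411ii_inst_of_isSlim_of_isOfFSMType F₁ F₂ Ψ hF₁ hF₂ hD₁ hD₂ hsl₁ hsl₂ hs
  · -- not of group-like type, on both sides (group-like type is preserved by `Ψ⁻¹`)
    have hG₂ : ¬ (PreFrobenioidData.ofFunctor Φ₂ F₂).IsOfGroupLikeType := fun h =>
      hG₁ (FrdI.isOfGroupLikeType_map hF₂ hF₁ hq₂ hq₁ hD₂ hD₁ Ψ.symm h)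
    obtain ⟨N₁, hN₁⟩ : ∃ A : C₁, ¬ IsGroupLikeObj F₁ A := by
      by_contra h
      exact hG₁ ⟨fun A => (PreFrobenioidData.ofFunctor_isGroupLikeObj F₁ A).2 (not_exists_not.mp h A)⟩
    obtain ⟨N₂, hN₂⟩ : ∃ A : C₂, ¬ IsGroupLikeObj F₂ A := by
      by_contra h
      exact hG₂ ⟨fun A => (PreFrobenioidData.ofFunctor_isGroupLikeObj F₂ A).2 (not_exists_not.mp h A)⟩
    -- the isotropic parts `C_i^istr` (Frobenioids of isotropic, hence quasi-isotropic, type; same `Φ_i`, `D_i`)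
    haveI : (isotropicObjects F₂).IsClosedUnderIsomorphisms :=
      ⟨fun e h => IsIsotropic.of_iso hF₂.isPreFrobenioid e.symm h⟩
    let Ψi := Ψ.congrFullSubcategory (FrdI.isotropicObjects_inverseImage hF₁ hq₁ hq₂ Ψ)
    have hI₁ := isFrobenioid_istr hF₁
    have hI₂ := isFrobenioid_istr hF₂
    have hiI₁ : IsOfIsotropicType (istrFunctor F₁) := isOfIsotropicType_istr
    have hiI₂ : IsOfIsotropicType (istrFunctor F₂) := isOfIsotropicType_istr
    have hqI₁ : (PreFrobenioidData.ofFunctor Φ₁ (istrFunctor F₁)).IsOfQuasiIsotropicType :=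
      isOfQuasiIsotropicType_of_isOfIsotropicType Φ₁ (istrFunctor F₁) hI₁
        ((PreFrobenioidData.ofFunctor_isOfIsotropicType _).mpr hiI₁)
    have hqI₂ : (PreFrobenioidData.ofFunctor Φ₂ (istrFunctor F₂)).IsOfQuasiIsotropicType :=
      isOfQuasiIsotropicType_of_isOfIsotropicType Φ₂ (istrFunctor F₂) hI₂
        ((PreFrobenioidData.ofFunctor_isOfIsotropicType _).mpr hiI₂)
    have hndI₁ : (PreFrobenioidData.ofFunctor Φ₁ (istrFunctor F₁)).IsNonDilatingOn :=
      ⟨hs.standard.1.nonDilating.nonDilating⟩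
    have hndI₂ : (PreFrobenioidData.ofFunctor Φ₂ (istrFunctor F₂)).IsNonDilatingOn :=
      ⟨hs.standard.2.nonDilating.nonDilating⟩
    have hndE₁ : Literature.AlgebraicGeometry.Frobenioids.IsNonDilatingOn Φ₁ :=
      FrdI.isNonDilatingOn_of_ofFunctor hs.standard.1.nonDilating
    have hndE₂ : Literature.AlgebraicGeometry.Frobenioids.IsNonDilatingOn Φ₂ :=
      FrdI.isNonDilatingOn_of_ofFunctor hs.standard.2.nonDilating
    -- non-group-like objects of the `C_i^istr`: the isotropic hulls of `N_i` (the hull is a base-isomorphism)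
    have hNI₁ : ¬ IsGroupLikeObj (istrFunctor F₁) ((isotropification hF₁).obj N₁) := fun h =>
      hN₁ (isGroupLikeObj_of_isBaseIso (hullHom hF₁ N₁) (isIsotropicHull_hullHom hF₁ N₁).2.1.2 h)
    have hNI₂ : ¬ IsGroupLikeObj (istrFunctor F₂) ((isotropification hF₂).obj N₂) := fun h =>
      hN₂ (isGroupLikeObj_of_isBaseIso (hullHom hF₂ N₂) (isIsotropicHull_hullHom hF₂ N₂).2.1.2 h)
    -- `Ψ^istr` is compatible with arrows of Frobenius type (Thm. 3.4 (iii))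
    have hΨi : IsFrobeniusCompatible (istrFunctor F₁) (istrFunctor F₂) Ψi.functor :=
      FrdI.T42.isFrobeniusCompatible_of_isOfFSMType Ψi hI₁ hI₂ hqI₁ hqI₂ hndE₁ hndE₂ hD₁ hD₂ hNI₁ hNI₂
    -- the setting of the proof of Thm. 4.2 for `(Ψ^istr)^pf` on the perfections `(C_i^istr)^pf`
    have S := FrdI.T42.setting_perfection Ψi hI₁ hI₂ hPf₁ hPf₂ hiI₁ hiI₂ hpf₁ hpf₂ hndI₁ hndI₂ hD₁ hD₂
      hNI₁ hNI₂ hΨi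
    haveI := Perfection.map_isEquivalence (hF₁ := hI₁) (hF₂ := hI₂) Ψi hΨi
    exact cor411ii_of_congr_istr_pf hF₁ hF₂ Ψ hs hΨi
      (Perfection.map (hF₁ := hI₁) (hF₂ := hI₂) hΨi).asEquivalence rfl S _ _ hB₁ hB₂
      (fun _ _ φ hφ => S.isPrimaryPreStep_map hφ) (fun _ _ φ hφ => S.symm.isPrimaryPreStep_map hφ) hs

set_option backward.isDefEq.respectTransparency false in
/-- **[FrdI] Cor. 4.11 (ii) AS TYPED over bases of FSM-type, by the amended route through `C^un-tr`**:
for Frobenioids `C_i → F_{Φ_i}` with `Φ_i` perf-factorial over bases `D_i` of FSM-type and an equivalence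
`Ψ : C₁ ⥲ C₂`: if the `D_i` are Div-slim (w.r.t. `Φ_i`) and the `C_i` are of standard type (hypothesis (b) of
Thm. 3.4 (iii) being part of the typed setting), there is a `1`-unique base equivalence `Ψ^Base : D₁ ⥲ D₂` under
`Ψ`, and for slim `D_i` the composites `C₁ → D₂` are rigid. Route: group-like ⇒ Div-slim = slim ⇒ Thm. 3.4 (v);
else restrict to `C_i^istr` (Thm. 3.4 (i); standard type by Rem. 4.5.1, `isOfStandardType_istr`), where
Thm. 4.2 (i) (`FrdI.T42.thm42i_ofFunctor_of_isOfFSMType`: `Ψ^istr` preserves Div-identity endomorphisms) and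
Cor. 4.11 (i) give `Ψ^un-tr : (C₁^istr)^un-tr ⥲ (C₂^istr)^un-tr` over `Ψ^istr` (`cor411i_restrict`);
`(C_i^istr)^un-tr → F_{Φ_i}` are Frobenioids of standard, isotropic, unit-trivial type over the same Div-slim
bases, so `cor411ii_of_isOfFSMType` applies to `Ψ^un-tr` — its inputs "the perfections are Frobenioids"
(Prop. 3.2 (iii), `Perfection.isFrobenioid`) and "their birationalizations are Frobenioids" (Prop. 4.4 (ii)
as amended, unit-trivial type: `Perfection.birat_isFrobenioid_of_isOfUnitTrivialType`) being PROVED — and the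
resulting base square descends along `C_i → C_i^istr → (C_i^istr)^un-tr` (`cor411ii_of_over`).
[cite: MochizukiFrdI2008, Cor. 4.11 (ii) p.91] -/
theorem cor411ii_ofFunctor_of_isOfFSMType (hF₁ : IsFrobenioid F₁) (hF₂ : IsFrobenioid F₂) (Ψ : C₁ ≌ C₂)
    (hpf₁ : Objectwise (fun M _ => IsPerfFactorial M) Φ₁) (hpf₂ : Objectwise (fun M _ => IsPerfFactorial M) Φ₂)
    (hD₁ : IsOfFSMType D₁) (hD₂ : IsOfFSMType D₂) :
    (PreFrobenioidData.ofFunctor Φ₁ F₁).Cor411ii (PreFrobenioidData.ofFunctor Φ₂ F₂) Ψ := by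
  classical
  intro hs
  have hq₁ := hs.standard.1.quasiIsotropic
  have hq₂ := hs.standard.2.quasiIsotropic
  by_cases hG₁ : (PreFrobenioidData.ofFunctor Φ₁ F₁).IsOfGroupLikeType
  · -- group-like type: "Div-slimness amounts to slimness", and the slim case is Thm. 3.4 (v)
    have hG₂ : (PreFrobenioidData.ofFunctor Φ₂ F₂).IsOfGroupLikeType :=
      FrdI.isOfGroupLikeType_map hF₁ hF₂ hq₁ hq₂ hD₁ hD₂ Ψ hG₁
    have hsl₁ : IsSlim D₁ := PreFrobenioidData.isSlim_of_isDivSlim_of_isOfGroupLikeType _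
      (exists_base_iso_of_isFrobenioid F₁ hF₁) hG₁ hs.divSlim.1
    have hsl₂ : IsSlim D₂ := PreFrobenioidData.isSlim_of_isDivSlim_of_isOfGroupLikeType _
      (exists_base_iso_of_isFrobenioid F₂ hF₂) hG₂ hs.divSlim.2
    exact cor411ii_inst_of_isSlim_of_isOfFSMType F₁ F₂ Ψ hF₁ hF₂ hD₁ hD₂ hsl₁ hsl₂ hs
  · -- not of group-like type, on both sides
    have hG₂ : ¬ (PreFrobenioidData.ofFunctor Φ₂ F₂).IsOfGroupLikeType := fun h =>
      hG₁ (FrdI.isOfGroupLikeType_map hF₂ hF₁ hq₂ hq₁ hD₂ hD₁ Ψ.symm h)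
    -- the isotropic parts `C_i^istr → F_{Φ_i}` and `Ψ^istr` (Thm. 3.4 (i))
    haveI : (isotropicObjects F₂).IsClosedUnderIsomorphisms :=
      ⟨fun e h => IsIsotropic.of_iso hF₂.isPreFrobenioid e.symm h⟩
    have hinv := FrdI.isotropicObjects_inverseImage hF₁ hq₁ hq₂ Ψ
    let Ψif := Ψ.congrFullSubcategory hinv
    have hI₁ := isFrobenioid_istr hF₁
    have hI₂ := isFrobenioid_istr hF₂
    have hSI₁ := isOfStandardType_istr hF₁ hs.standard.1
    have hSI₂ := isOfStandardType_istr hF₂ hs.standard.2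
    have hGI₁ : ¬ (PreFrobenioidData.ofFunctor Φ₁ (istrFunctor F₁)).IsOfGroupLikeType := fun h =>
      hG₁ (isOfGroupLikeType_of_istr' hF₁ h)
    have hGI₂ : ¬ (PreFrobenioidData.ofFunctor Φ₂ (istrFunctor F₂)).IsOfGroupLikeType := fun h =>
      hG₂ (isOfGroupLikeType_of_istr' hF₂ h)
    have hBI : (PreFrobenioidData.ofFunctor Φ₁ (istrFunctor F₁)).HypB
        (PreFrobenioidData.ofFunctor Φ₂ (istrFunctor F₂)) Ψif := fun g _ => (hGI₁ g).elim
    have hBI' : (PreFrobenioidData.ofFunctor Φ₂ (istrFunctor F₂)).HypB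
        (PreFrobenioidData.ofFunctor Φ₁ (istrFunctor F₁)) Ψif.symm := fun g _ => (hGI₂ g).elim
    have hsI : (PreFrobenioidData.ofFunctor Φ₁ (istrFunctor F₁)).Cor411Setting
        (PreFrobenioidData.ofFunctor Φ₂ (istrFunctor F₂)) Ψif :=
      { divSlim := ⟨⟨hs.divSlim.1.eq_one⟩, ⟨hs.divSlim.2.eq_one⟩⟩
        standard := ⟨hSI₁, hSI₂⟩
        hypB := hBI }
    -- Thm. 3.4 (iii) at the isotropic parts over FSM-type bases: pull-back morphisms for `Ψ^istr`, `(Ψ^istr)⁻¹`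
    have h3 := FrdI.thm34iii_ofFunctor_of_isOfFSMType hI₁ hI₂ hD₁ hD₂ Ψif hSI₁ hSI₂ hBI
    have h3' := FrdI.thm34iii_ofFunctor_of_isOfFSMType hI₂ hI₁ hD₂ hD₁ Ψif.symm hSI₂ hSI₁ hBI'
    have hisoI : ∀ X : Istr F₁, (PreFrobenioidData.ofFunctor Φ₂ (istrFunctor F₂)).IsIsotropic (Ψif.functor.obj X) ↔
        (PreFrobenioidData.ofFunctor Φ₁ (istrFunctor F₁)).IsIsotropic X := fun X =>
      ⟨fun _ => (PreFrobenioidData.ofFunctor_isIsotropic _ _).mpr (isOfIsotropicType_istr X),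
        fun _ => (PreFrobenioidData.ofFunctor_isIsotropic _ _).mpr (isOfIsotropicType_istr _)⟩
    -- Thm. 4.2 (i) at the isotropic parts: `Ψ^istr`, `(Ψ^istr)⁻¹` preserve Div-identity endomorphisms
    have hiI₁ : (PreFrobenioidData.ofFunctor Φ₁ (istrFunctor F₁)).IsOfIsotropicType :=
      (PreFrobenioidData.ofFunctor_isOfIsotropicType _).mpr isOfIsotropicType_istr
    have hiI₂ : (PreFrobenioidData.ofFunctor Φ₂ (istrFunctor F₂)).IsOfIsotropicType :=
      (PreFrobenioidData.ofFunctor_isOfIsotropicType _).mpr isOfIsotropicType_istr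
    have hT : PreFrobenioidData.Thm42Setting (PreFrobenioidData.ofFunctor Φ₁ (istrFunctor F₁))
        (PreFrobenioidData.ofFunctor Φ₂ (istrFunctor F₂)) := ⟨⟨hSI₁, hSI₂⟩, ⟨hiI₁, hiI₂⟩, ⟨hGI₁, hGI₂⟩⟩
    have hT' : PreFrobenioidData.Thm42Setting (PreFrobenioidData.ofFunctor Φ₂ (istrFunctor F₂))
        (PreFrobenioidData.ofFunctor Φ₁ (istrFunctor F₁)) := ⟨⟨hSI₂, hSI₁⟩, ⟨hiI₂, hiI₁⟩, ⟨hGI₂, hGI₁⟩⟩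
    have hdiI : ∀ (X : Istr F₁) (φ : X ⟶ X), (PreFrobenioidData.ofFunctor Φ₁ (istrFunctor F₁)).IsDivIdentity φ →
        (PreFrobenioidData.ofFunctor Φ₂ (istrFunctor F₂)).IsDivIdentity (Ψif.functor.map φ) :=
      (FrdI.T42.thm42i_ofFunctor_of_isOfFSMType Ψif hI₁ hI₂ hpf₁ hpf₂ hD₁ hD₂ hT).2.1
    have hdiI' : ∀ (Y : Istr F₂) (φ : Y ⟶ Y), (PreFrobenioidData.ofFunctor Φ₂ (istrFunctor F₂)).IsDivIdentity φ →
        (PreFrobenioidData.ofFunctor Φ₁ (istrFunctor F₁)).IsDivIdentity (Ψif.inverse.map φ) :=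
      (FrdI.T42.thm42i_ofFunctor_of_isOfFSMType Ψif.symm hI₂ hI₁ hpf₂ hpf₁ hD₂ hD₁ hT').2.1
    -- Cor. 4.11 (i) at the isotropic parts: `Ψ^un-tr` over `Ψ^istr` (restricted to all of `C^istr`)
    obtain ⟨Ψistr, hcomm, hcor⟩ := cor411i_restrict (istrFunctor F₁) (istrFunctor F₂) Ψif hI₁ hI₂ hisoI
      ⟨hs.divSlim.1.eq_one⟩ ⟨hs.divSlim.2.eq_one⟩ h3.1.2.2.2.2.1 h3'.1.2.2.2.2.1 hdiI hdiI'
    obtain ⟨Ψuntr, ⟨hEqU, ⟨τU⟩, -⟩, -⟩ := hcor hsI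
    haveI := hEqU
    -- the unit-trivializations `(C_i^istr)^un-tr → F_{Φ_i}`: Frobenioids of standard, isotropic, unit-trivial type
    have hU₁ := isFrobenioid_untr hI₁
    have hU₂ := isFrobenioid_untr hI₂
    have hngU₁ : ¬ (PreFrobenioidData.ofFunctor Φ₁ (untrFunctor hI₁)).IsOfGroupLikeType := fun h =>
      hGI₁ (isOfGroupLikeType_of_untrData hI₁ h)
    have hsU : (PreFrobenioidData.ofFunctor Φ₁ (untrFunctor hI₁)).Cor411Setting
        (PreFrobenioidData.ofFunctor Φ₂ (untrFunctor hI₂)) Ψuntr.asEquivalence :=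
      { divSlim := ⟨⟨hs.divSlim.1.eq_one⟩, ⟨hs.divSlim.2.eq_one⟩⟩
        standard := ⟨isOfStandardType_untr hI₁ hGI₁ hSI₁, isOfStandardType_untr hI₂ hGI₂ hSI₂⟩
        hypB := fun hg _ => (hngU₁ hg).elim }
    -- Prop. 3.2 (iii) for the isotropic parts of the unit-trivializations: PROVED (Frobenius-isotropic type)
    have hPf₁ : IsFrobenioid (Perfection.ops (isFrobenioid_istr hU₁)).toFunctor :=
      Perfection.isFrobenioid _
        (FrdI.T42.isFrobeniusIsotropic_of_isOfIsotropicType (isFrobenioid_istr hU₁) isOfIsotropicType_istr)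
    have hPf₂ : IsFrobenioid (Perfection.ops (isFrobenioid_istr hU₂)).toFunctor :=
      Perfection.isFrobenioid _
        (FrdI.T42.isFrobeniusIsotropic_of_isOfIsotropicType (isFrobenioid_istr hU₂) isOfIsotropicType_istr)
    have hBU₁ := Perfection.birat_isFrobenioid_of_isOfUnitTrivialType (isFrobenioid_istr hU₁) hPf₁
      isOfIsotropicType_istr (isOfUnitTrivialType_istr_of _ (isOfUnitTrivialType_untr hI₁))
    have hBU₂ := Perfection.birat_isFrobenioid_of_isOfUnitTrivialType (isFrobenioid_istr hU₂) hPf₂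
      isOfIsotropicType_istr (isOfUnitTrivialType_istr_of _ (isOfUnitTrivialType_untr hI₂))
    -- the base square of `Ψ^un-tr`
    obtain ⟨ΨBase, ⟨hEqB, hsqB, -⟩, -⟩ :=
      cor411ii_of_isOfFSMType hU₁ hU₂ Ψuntr.asEquivalence hpf₁ hpf₂ hD₁ hD₂ hPf₁ hPf₂ hBU₁ hBU₂ hsU
    -- the floors `C_i → C_i^istr → (C_i^istr)^istr → (C_i^istr)^un-tr` over `D_i`
    let L₁ : Istr F₁ ⥤ (PreFrobenioidData.ofFunctor Φ₁ (istrFunctor F₁)).Istr :=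
      (PreFrobenioidData.ofFunctor Φ₁ (istrFunctor F₁)).isotropicObjects.lift (𝟭 _) fun X =>
        (PreFrobenioidData.ofFunctor_isIsotropic _ _).mpr (isOfIsotropicType_istr X)
    let L₂ : Istr F₂ ⥤ (PreFrobenioidData.ofFunctor Φ₂ (istrFunctor F₂)).Istr :=
      (PreFrobenioidData.ofFunctor Φ₂ (istrFunctor F₂)).isotropicObjects.lift (𝟭 _) fun X =>
        (PreFrobenioidData.ofFunctor_isIsotropic _ _).mpr (isOfIsotropicType_istr X)
    have hL₁ : L₁ ⋙ (PreFrobenioidData.ofFunctor Φ₁ (istrFunctor F₁)).istrι = 𝟭 _ :=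
      Functor.hext (fun _ => rfl) fun _ _ _ => HEq.rfl
    have hL₂ : L₂ ⋙ (PreFrobenioidData.ofFunctor Φ₂ (istrFunctor F₂)).istrι = 𝟭 _ :=
      Functor.hext (fun _ => rfl) fun _ _ _ => HEq.rfl
    let T₁ := (isotropification hF₁ ⋙ L₁) ⋙ (PreFrobenioidData.ofFunctor Φ₁ (istrFunctor F₁)).toUntr
    let T₂ := (isotropification hF₂ ⋙ L₂) ⋙ (PreFrobenioidData.ofFunctor Φ₂ (istrFunctor F₂)).toUntr
    have ιU₁ : (PreFrobenioidData.ofFunctor Φ₁ (istrFunctor F₁)).toUntr ⋙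
        (PreFrobenioidData.ofFunctor Φ₁ (untrFunctor hI₁)).base ≅
          (PreFrobenioidData.ofFunctor Φ₁ (istrFunctor F₁)).istrι ⋙ (PreFrobenioidData.ofFunctor Φ₁ (istrFunctor F₁)).base :=
      eqToIso (Functor.hext (fun _ => rfl) fun _ _ a => heq_of_eq (base_toUntr (hF := hI₁) a))
    have ιU₂ : (PreFrobenioidData.ofFunctor Φ₂ (istrFunctor F₂)).toUntr ⋙
        (PreFrobenioidData.ofFunctor Φ₂ (untrFunctor hI₂)).base ≅
          (PreFrobenioidData.ofFunctor Φ₂ (istrFunctor F₂)).istrι ⋙ (PreFrobenioidData.ofFunctor Φ₂ (istrFunctor F₂)).base :=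
      eqToIso (Functor.hext (fun _ => rfl) fun _ _ a => heq_of_eq (base_toUntr (hF := hI₂) a))
    obtain ⟨ιf₁⟩ := nonempty_base_iso_isotropification_comp hF₁
    obtain ⟨ιf₂⟩ := nonempty_base_iso_isotropification_comp hF₂
    have ι₁ : T₁ ⋙ (PreFrobenioidData.ofFunctor Φ₁ (untrFunctor hI₁)).base ≅ (PreFrobenioidData.ofFunctor Φ₁ F₁).base :=
      Functor.associator _ _ _ ≪≫ Functor.isoWhiskerLeft _ ιU₁ ≪≫ Functor.associator _ _ _ ≪≫
        Functor.isoWhiskerLeft (isotropification hF₁) ((Functor.associator _ _ _).symm ≪≫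
          Functor.isoWhiskerRight (eqToIso hL₁) _ ≪≫ Functor.leftUnitor _) ≪≫ ιf₁
    have ι₂ : T₂ ⋙ (PreFrobenioidData.ofFunctor Φ₂ (untrFunctor hI₂)).base ≅ (PreFrobenioidData.ofFunctor Φ₂ F₂).base :=
      Functor.associator _ _ _ ≪≫ Functor.isoWhiskerLeft _ ιU₂ ≪≫ Functor.associator _ _ _ ≪≫
        Functor.isoWhiskerLeft (isotropification hF₂) ((Functor.associator _ _ _).symm ≪≫
          Functor.isoWhiskerRight (eqToIso hL₂) _ ≪≫ Functor.leftUnitor _) ≪≫ ιf₂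
    -- `Ψ^istr` over `Ψ` along the isotropifications (Thm. 3.4 (i): uniqueness of left adjoints)
    obtain ⟨core⟩ := nonempty_isotropification_comp_iso hF₁ hF₂ hq₁ hq₂ Ψ
    have HL : ((isotropification hF₁ ⋙ L₁) ⋙ Ψistr.functor) ⋙ (PreFrobenioidData.ofFunctor Φ₂ (istrFunctor F₂)).istrι ≅
        isotropification hF₁ ⋙ Ψif.functor :=
      Functor.associator _ _ _ ≪≫ Functor.isoWhiskerLeft _ (eqToIso hcomm) ≪≫ Functor.associator _ _ _ ≪≫
        Functor.isoWhiskerLeft (isotropification hF₁)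
          ((Functor.associator _ _ _).symm ≪≫ Functor.isoWhiskerRight (eqToIso hL₁) _ ≪≫ Functor.leftUnitor _)
    have HR : (Ψ.functor ⋙ (isotropification hF₂ ⋙ L₂)) ⋙ (PreFrobenioidData.ofFunctor Φ₂ (istrFunctor F₂)).istrι ≅
        isotropification hF₁ ⋙ Ψif.functor :=
      Functor.associator _ _ _ ≪≫
        Functor.isoWhiskerLeft Ψ.functor (Functor.associator _ _ _ ≪≫
          Functor.isoWhiskerLeft (isotropification hF₂) (eqToIso hL₂) ≪≫ Functor.rightUnitor _) ≪≫ core.symm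
    have G : (isotropification hF₁ ⋙ L₁) ⋙ Ψistr.functor ≅ Ψ.functor ⋙ (isotropification hF₂ ⋙ L₂) :=
      ((PreFrobenioidData.ofFunctor Φ₂ (istrFunctor F₂)).isotropicObjects.fullyFaithfulι.whiskeringRight C₁).preimageIso
        (HL ≪≫ HR.symm)
    have hT : OneCommutes Ψ.functor T₂ T₁ Ψuntr :=
      ⟨(Functor.associator _ _ _).symm ≪≫ Functor.isoWhiskerRight G.symm _ ≪≫ Functor.associator _ _ _ ≪≫
        Functor.isoWhiskerLeft _ τU ≪≫ (Functor.associator _ _ _).symm⟩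
    -- descend
    exact cor411ii_of_over hF₁ hF₂ Ψ T₁ T₂ _ _ ι₁ ι₂ Ψuntr hT ⟨ΨBase, hEqB, hsqB⟩ hs

end Two

end PreFrobenioid

end Literature.AlgebraicGeometry.Frobenioids
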